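import Mathlib
import HarnessLib

/-!
# The finite-dimensional core of TORUS-SEP (helper file for stub TORUS-SEP)

Route `WeilParity`, crux `OffLineParityDetection` (item stmt-RiemannHypothesis-15431), line
`registered`, stub `stub_torusTopHeavySeparated` (TORUS-SEP).  Pure finite-dimensional real
algebra (finite sums, Cauchy–Schwarz), no analysis, no zeta facts, no definitions.

Setting (TORUS-analysis §4–§5, with the index set a finite type `ι`, `card ι ≤ J`): weights
`m_i > 0`, three real `ι × ι` arrays `CC, SS, CS` (in the application: the Gram matrices
`⟨c_i, c_j⟩`, `⟨s_i, s_j⟩`, `⟨c_i, s_j⟩` of the cosine and sine families on `L²(0, ∞)`), the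
weighted quadratic forms `Q_C(z) = Σ_{ij} z_i z_j √m_i √m_j CC_{ij}`, `Q_S` likewise, and unit
maximisers `x` of `Q_C`, `y` of `Q_S` (Rayleigh quotients: `Q(z) ≤ Q(x) |z|²`).

* `torusSep_exists_max_form`: a quadratic form attains its maximum on the Euclidean unit sphere of
  `ι → ℝ` (compactness), in Rayleigh-quotient form.
* `torusSep_matrixInequality`: under the SIGN STRUCTURE (`SS ≥ 0` entrywise, `CC - SS ≥ 0`
  entrywise, `CC_ii - SS_ii ≥ u₀`), the SIZE BOUNDS (`SS_ij ≤ θ` off the diagonal,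
  `N - θ/4 ≤ SS_ii ≤ N ≤ CC_ii`, `|CS_ij| ≤ θ`) and the closing numerical condition
  `J²θ²(N + Jθ) < N u₀ (N - θ/4)`, the strict "top-heaviness" inequality
  `Q_S(y) · Q_C(x) < Σ_i m_i (Σ_j x_j √m_j CC_ji)² - Σ_i m_i (Σ_j x_j √m_j CS_ji)²` holds.
  Proof: Perron–Frobenius by hand (`Q_S(y) ≤ Q_S(|y|)`, `Q_C(|y|) - Q_S(|y|) ≥ u₀ Σ m_i y_i²`),
  the Schur test (`Q_S(y) ≤ (Σ m_i y_i²)(N + Jθ)`), test vectors `e_{i₀}` at the heaviest index,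
  and Cauchy–Schwarz twice (gain part `≥ Q_C(x)²`, leakage `≤ J² m_max² θ²`).

Everything is folklore linear algebra and fully proved.
-/

set_option linter.dupNamespace false

noncomputable section

namespace Summit.RiemannHypothesis.RiemannHypothesis.Theorems.WeilParityOffLineParityDetection

open Finset

/-! ## Maximisers of quadratic forms on the unit sphere -/

/-- A real quadratic form `z ↦ Σ_{ij} z_i z_j B_{ij}` on `ι → ℝ` (`ι` finite, nonempty) has a
maximiser `x` on the Euclidean unit sphere, in Rayleigh form: `Q(z) ≤ Q(x) Σ z_i²` for all `z`.
[folklore] -/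
theorem torusSep_exists_max_form {ι : Type*} [Fintype ι] [Nonempty ι] (B : ι → ι → ℝ) :
    ∃ x : ι → ℝ, ∑ i, x i ^ 2 = 1 ∧
      ∀ z : ι → ℝ, ∑ i, ∑ j, z i * z j * B i j ≤ (∑ i, ∑ j, x i * x j * B i j) * ∑ i, z i ^ 2 := by
  classical
  set S : Set (ι → ℝ) := {x | ∑ i, x i ^ 2 = 1} with hS
  have hcont : Continuous fun x : ι → ℝ ↦ ∑ i, x i ^ 2 := by fun_prop
  have hclosed : IsClosed S := isClosed_eq hcont continuous_const
  have hbdd : Bornology.IsBounded S := by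
    refine (Metric.isBounded_closedBall (x := (0 : ι → ℝ)) (r := 1)).subset fun x hx ↦ ?_
    rw [Metric.mem_closedBall, dist_zero_right, pi_norm_le_iff_of_nonneg zero_le_one]
    intro i
    rw [Real.norm_eq_abs]
    have h1 : x i ^ 2 ≤ ∑ j, x j ^ 2 :=
      Finset.single_le_sum (f := fun j ↦ x j ^ 2) (fun j _ ↦ sq_nonneg (x j)) (Finset.mem_univ i)
    have hx1 : ∑ j, x j ^ 2 = 1 := hx
    exact abs_le_of_sq_le_sq (by rw [one_pow]; linarith) zero_le_one
  have hcpt : IsCompact S := Metric.isCompact_of_isClosed_isBounded hclosed hbdd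
  obtain ⟨i₀⟩ := ‹Nonempty ι›
  have hne : S.Nonempty := by
    refine ⟨Pi.single i₀ 1, ?_⟩
    show ∑ i, (Pi.single i₀ (1 : ℝ) : ι → ℝ) i ^ 2 = 1
    simp [Pi.single_apply]
  have hQ : Continuous fun x : ι → ℝ ↦ ∑ i, ∑ j, x i * x j * B i j := by fun_prop
  obtain ⟨x, hxS, hxmax⟩ := hcpt.exists_isMaxOn hne hQ.continuousOn
  refine ⟨x, hxS, fun z ↦ ?_⟩
  set r := ∑ i, z i ^ 2 with hr
  have hr0 : 0 ≤ r := Finset.sum_nonneg fun i _ ↦ sq_nonneg (z i)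
  rcases hr0.eq_or_lt with hr0 | hr0
  · -- `z = 0`
    have hz : ∀ i, z i = 0 := by
      intro i
      have h := (Finset.sum_eq_zero_iff_of_nonneg fun j _ ↦ sq_nonneg (z j)).1 hr0.symm i
        (Finset.mem_univ i)
      exact pow_eq_zero_iff two_ne_zero |>.1 h
    have h0 : ∑ i, ∑ j, z i * z j * B i j = 0 := by simp [hz]
    rw [h0, ← hr0, mul_zero]
  · set y : ι → ℝ := fun i ↦ z i / Real.sqrt r with hy
    have hsq : Real.sqrt r * Real.sqrt r = r := Real.mul_self_sqrt hr0.le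
    have hyS : y ∈ S := by
      show ∑ i, (z i / Real.sqrt r) ^ 2 = 1
      simp_rw [div_pow, Real.sq_sqrt hr0.le, ← Finset.sum_div]
      exact div_self hr0.ne'
    have h := hxmax hyS
    have hQy : ∑ i, ∑ j, y i * y j * B i j = (∑ i, ∑ j, z i * z j * B i j) / r := by
      rw [Finset.sum_div]
      refine Finset.sum_congr rfl fun i _ ↦ ?_
      rw [Finset.sum_div]
      refine Finset.sum_congr rfl fun j _ ↦ ?_
      rw [hy]
      dsimp only
      rw [div_mul_div_comm, hsq]
      ring
    have h' : (∑ i, ∑ j, z i * z j * B i j) / r ≤ ∑ i, ∑ j, x i * x j * B i j := by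
      rw [← hQy]
      exact h
    exact (div_le_iff₀ hr0).1 h'

/-! ## The matrix inequality -/

/-- **The finite-dimensional core of TORUS-SEP.**  See the module docstring: with unit
maximisers `x` of `Q_C` and `y` of `Q_S`, the sign structure, the size bounds and the closing
condition `J²θ²(N + Jθ) < N u₀ (N - θ/4)` imply
`Q_S(y) Q_C(x) < Σ_i m_i (Σ_j x_j √m_j CC_ji)² - Σ_i m_i (Σ_j x_j √m_j CS_ji)²`. [folklore] -/
theorem torusSep_matrixInequality {ι : Type*} [Fintype ι] [DecidableEq ι]
    (m : ι → ℝ) (CC SS CS : ι → ι → ℝ) (x y : ι → ℝ) (N θ u₀ J : ℝ)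
    (hm : ∀ i, 0 < m i) (hx1 : ∑ i, x i ^ 2 = 1)
    (hxmax : ∀ z : ι → ℝ, ∑ i, ∑ j, z i * z j * (Real.sqrt (m i) * Real.sqrt (m j) * CC i j) ≤
      (∑ i, ∑ j, x i * x j * (Real.sqrt (m i) * Real.sqrt (m j) * CC i j)) * ∑ i, z i ^ 2)
    (hy1 : ∑ i, y i ^ 2 = 1)
    (hymax : ∀ z : ι → ℝ, ∑ i, ∑ j, z i * z j * (Real.sqrt (m i) * Real.sqrt (m j) * SS i j) ≤
      (∑ i, ∑ j, y i * y j * (Real.sqrt (m i) * Real.sqrt (m j) * SS i j)) * ∑ i, z i ^ 2)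
    (hN : 0 < N) (hθ : 0 ≤ θ) (hu : 0 < u₀) (hJ : (Fintype.card ι : ℝ) ≤ J)
    (hCCsym : ∀ i j, CC i j = CC j i)
    (hSS0 : ∀ i j, 0 ≤ SS i j) (hSSθ : ∀ i j, i ≠ j → SS i j ≤ θ) (hSSN : ∀ i, SS i i ≤ N)
    (hSSN' : ∀ i, N - θ / 4 ≤ SS i i)
    (hU : ∀ i j, SS i j ≤ CC i j) (hUd : ∀ i, SS i i + u₀ ≤ CC i i) (hCCN : ∀ i, N ≤ CC i i)
    (hCS : ∀ i j, |CS i j| ≤ θ)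
    (hclose : J ^ 2 * θ ^ 2 * (N + J * θ) < N * u₀ * (N - θ / 4)) :
    (∑ i, ∑ j, y i * y j * (Real.sqrt (m i) * Real.sqrt (m j) * SS i j)) *
        (∑ i, ∑ j, x i * x j * (Real.sqrt (m i) * Real.sqrt (m j) * CC i j)) <
      ∑ i, m i * (∑ j, x j * Real.sqrt (m j) * CC j i) ^ 2 -
        ∑ i, m i * (∑ j, x j * Real.sqrt (m j) * CS j i) ^ 2 := by
  -- freeze the two Rayleigh maxima as opaque reals `Λc`, `Λs`
  generalize hΛc : ∑ i, ∑ j, x i * x j * (Real.sqrt (m i) * Real.sqrt (m j) * CC i j) = Λc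
    at hxmax ⊢
  generalize hΛs : ∑ i, ∑ j, y i * y j * (Real.sqrt (m i) * Real.sqrt (m j) * SS i j) = Λs
    at hymax ⊢
  -- the index type is nonempty; the heaviest index `i₀`
  have hne : Nonempty ι := by
    by_contra h
    rw [not_nonempty_iff] at h
    simp at hx1
  obtain ⟨i₀, hi₀⟩ := Finite.exists_max m
  have hM0 : 0 < m i₀ := hm i₀
  have hJ0 : 0 ≤ J := le_trans (Nat.cast_nonneg _) hJ
  -- test vector `e_{i₀}`
  have hQe : ∀ B : ι → ι → ℝ, ∑ i, ∑ j, (Pi.single i₀ (1 : ℝ) : ι → ℝ) i *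
      (Pi.single i₀ (1 : ℝ) : ι → ℝ) j * (Real.sqrt (m i) * Real.sqrt (m j) * B i j) =
        m i₀ * B i₀ i₀ := by
    intro B
    have h : ∀ i j : ι, (Pi.single i₀ (1 : ℝ) : ι → ℝ) i * (Pi.single i₀ (1 : ℝ) : ι → ℝ) j *
        (Real.sqrt (m i) * Real.sqrt (m j) * B i j) =
        if j = i₀ then (if i = i₀ then Real.sqrt (m i) * Real.sqrt (m j) * B i j else 0)
          else 0 := by
      intro i j
      simp only [Pi.single_apply]
      split_ifs <;> simp
    simp_rw [h, Finset.sum_ite_eq', Finset.mem_univ, if_true]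
    rw [Finset.sum_ite_eq', if_pos (Finset.mem_univ _), Real.mul_self_sqrt hM0.le]
  have he1 : ∑ i, (Pi.single i₀ (1 : ℝ) : ι → ℝ) i ^ 2 = 1 := by simp [Pi.single_apply]
  have hΛc_ge : m i₀ * N ≤ Λc := by
    have h := hxmax (Pi.single i₀ 1)
    rw [hQe, he1, mul_one] at h
    exact le_trans (mul_le_mul_of_nonneg_left (hCCN i₀) hM0.le) h
  have hΛs_ge : m i₀ * (N - θ / 4) ≤ Λs := by
    have h := hymax (Pi.single i₀ 1)
    rw [hQe, he1, mul_one] at h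
    exact le_trans (mul_le_mul_of_nonneg_left (hSSN' i₀) hM0.le) h
  have hΛc0 : 0 < Λc := lt_of_lt_of_le (mul_pos hM0 hN) hΛc_ge
  -- Perron–Frobenius by hand: pass to `|y|`
  set W := ∑ i, m i * y i ^ 2 with hW
  have hW0 : 0 ≤ W := Finset.sum_nonneg fun i _ ↦ mul_nonneg (hm i).le (sq_nonneg _)
  set ya : ι → ℝ := fun i ↦ |y i| with hya
  have hya1 : ∑ i, ya i ^ 2 = 1 := by simp [hya, sq_abs, hy1]
  have hΛs_le_abs : Λs ≤ ∑ i, ∑ j, ya i * ya j * (Real.sqrt (m i) * Real.sqrt (m j) * SS i j) := by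
    rw [← hΛs]
    refine Finset.sum_le_sum fun i _ ↦ Finset.sum_le_sum fun j _ ↦ ?_
    have hc : 0 ≤ Real.sqrt (m i) * Real.sqrt (m j) * SS i j :=
      mul_nonneg (mul_nonneg (Real.sqrt_nonneg _) (Real.sqrt_nonneg _)) (hSS0 i j)
    calc y i * y j * (Real.sqrt (m i) * Real.sqrt (m j) * SS i j)
        ≤ |y i * y j| * (Real.sqrt (m i) * Real.sqrt (m j) * SS i j) :=
          mul_le_mul_of_nonneg_right (le_abs_self _) hc
      _ = ya i * ya j * (Real.sqrt (m i) * Real.sqrt (m j) * SS i j) := by rw [abs_mul]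
  have hdiag : u₀ * W ≤ ∑ i, ya i * ya i * (Real.sqrt (m i) * Real.sqrt (m i) * (CC i i - SS i i)) := by
    rw [hW, Finset.mul_sum]
    refine Finset.sum_le_sum fun i _ ↦ ?_
    have e1 : ya i * ya i = y i ^ 2 := by rw [hya]; dsimp only; rw [abs_mul_abs_self, sq]
    have e2 : Real.sqrt (m i) * Real.sqrt (m i) = m i := Real.mul_self_sqrt (hm i).le
    rw [e1, e2]
    have h1 := hUd i
    have h2 : 0 ≤ m i * y i ^ 2 := mul_nonneg (hm i).le (sq_nonneg _)
    nlinarith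
  have hoff : ∑ i, ya i * ya i * (Real.sqrt (m i) * Real.sqrt (m i) * (CC i i - SS i i)) ≤
      ∑ i, ∑ j, ya i * ya j * (Real.sqrt (m i) * Real.sqrt (m j) * (CC i j - SS i j)) := by
    refine Finset.sum_le_sum fun i _ ↦ ?_
    refine Finset.single_le_sum (f := fun j ↦ ya i * ya j *
      (Real.sqrt (m i) * Real.sqrt (m j) * (CC i j - SS i j))) (fun j _ ↦ ?_) (Finset.mem_univ i)
    have h1 : 0 ≤ CC i j - SS i j := sub_nonneg.2 (hU i j)
    exact mul_nonneg (mul_nonneg (abs_nonneg _) (abs_nonneg _))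
      (mul_nonneg (mul_nonneg (Real.sqrt_nonneg _) (Real.sqrt_nonneg _)) h1)
  have hsplit : ∑ i, ∑ j, ya i * ya j * (Real.sqrt (m i) * Real.sqrt (m j) * (CC i j - SS i j)) =
      ∑ i, ∑ j, ya i * ya j * (Real.sqrt (m i) * Real.sqrt (m j) * CC i j) -
        ∑ i, ∑ j, ya i * ya j * (Real.sqrt (m i) * Real.sqrt (m j) * SS i j) := by
    rw [← Finset.sum_sub_distrib]
    refine Finset.sum_congr rfl fun i _ ↦ ?_
    rw [← Finset.sum_sub_distrib]
    refine Finset.sum_congr rfl fun j _ ↦ ?_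
    ring
  have hQc_abs_le : ∑ i, ∑ j, ya i * ya j * (Real.sqrt (m i) * Real.sqrt (m j) * CC i j) ≤ Λc := by
    have h := hxmax ya
    rwa [hya1, mul_one] at h
  have hPF : Λs + u₀ * W ≤ Λc := by linarith
  -- Schur test: `Λs ≤ W (N + Jθ)`
  have hcardJ : ∀ i, (((univ : Finset ι).erase i).card : ℝ) * θ ≤ J * θ := by
    intro i
    refine mul_le_mul_of_nonneg_right (le_trans ?_ hJ) hθ
    exact_mod_cast (Finset.card_erase_le).trans (Finset.card_univ (α := ι)).le
  have hrow : ∀ i, ∑ j, SS i j ≤ N + J * θ := by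
    intro i
    rw [← Finset.add_sum_erase _ _ (Finset.mem_univ i)]
    have h1 : ∑ j ∈ univ.erase i, SS i j ≤ ∑ j ∈ univ.erase i, θ :=
      Finset.sum_le_sum fun j hj ↦ hSSθ i j (Finset.ne_of_mem_erase hj).symm
    rw [Finset.sum_const, nsmul_eq_mul] at h1
    linarith [hSSN i, hcardJ i]
  have hcol : ∀ j, ∑ i, SS i j ≤ N + J * θ := by
    intro j
    rw [← Finset.add_sum_erase _ _ (Finset.mem_univ j)]
    have h1 : ∑ i ∈ univ.erase j, SS i j ≤ ∑ i ∈ univ.erase j, θ :=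
      Finset.sum_le_sum fun i hi ↦ hSSθ i j (Finset.ne_of_mem_erase hi)
    rw [Finset.sum_const, nsmul_eq_mul] at h1
    linarith [hSSN j, hcardJ j]
  have hS1 : ∑ i, ∑ j, m i * y i ^ 2 / 2 * SS i j ≤ W * (N + J * θ) / 2 := by
    calc ∑ i, ∑ j, m i * y i ^ 2 / 2 * SS i j = ∑ i, m i * y i ^ 2 / 2 * ∑ j, SS i j := by
          simp_rw [Finset.mul_sum]
      _ ≤ ∑ i, m i * y i ^ 2 / 2 * (N + J * θ) :=
          Finset.sum_le_sum fun i _ ↦ mul_le_mul_of_nonneg_left (hrow i)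
            (div_nonneg (mul_nonneg (hm i).le (sq_nonneg _)) zero_le_two)
      _ = W * (N + J * θ) / 2 := by rw [← Finset.sum_mul, ← Finset.sum_div]; ring
  have hS2 : ∑ i, ∑ j, m j * y j ^ 2 / 2 * SS i j ≤ W * (N + J * θ) / 2 := by
    rw [Finset.sum_comm]
    calc ∑ j, ∑ i, m j * y j ^ 2 / 2 * SS i j = ∑ j, m j * y j ^ 2 / 2 * ∑ i, SS i j := by
          simp_rw [Finset.mul_sum]
      _ ≤ ∑ j, m j * y j ^ 2 / 2 * (N + J * θ) :=
          Finset.sum_le_sum fun j _ ↦ mul_le_mul_of_nonneg_left (hcol j)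
            (div_nonneg (mul_nonneg (hm j).le (sq_nonneg _)) zero_le_two)
      _ = W * (N + J * θ) / 2 := by rw [← Finset.sum_mul, ← Finset.sum_div]; ring
  have hSchur : Λs ≤ W * (N + J * θ) := by
    calc Λs ≤ ∑ i, ∑ j, ya i * ya j * (Real.sqrt (m i) * Real.sqrt (m j) * SS i j) := hΛs_le_abs
      _ ≤ ∑ i, ∑ j, (m i * y i ^ 2 / 2 * SS i j + m j * y j ^ 2 / 2 * SS i j) := by
          refine Finset.sum_le_sum fun i _ ↦ Finset.sum_le_sum fun j _ ↦ ?_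
          have hAM : ya i * ya j * (Real.sqrt (m i) * Real.sqrt (m j)) ≤
              m i * y i ^ 2 / 2 + m j * y j ^ 2 / 2 := by
            have h := two_mul_le_add_sq (ya i * Real.sqrt (m i)) (ya j * Real.sqrt (m j))
            have e1 : (ya i * Real.sqrt (m i)) ^ 2 = m i * y i ^ 2 := by
              rw [mul_pow, Real.sq_sqrt (hm i).le, hya]; dsimp only; rw [sq_abs]; ring
            have e2 : (ya j * Real.sqrt (m j)) ^ 2 = m j * y j ^ 2 := by
              rw [mul_pow, Real.sq_sqrt (hm j).le, hya]; dsimp only; rw [sq_abs]; ring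
            nlinarith
          calc ya i * ya j * (Real.sqrt (m i) * Real.sqrt (m j) * SS i j)
              = ya i * ya j * (Real.sqrt (m i) * Real.sqrt (m j)) * SS i j := by ring
            _ ≤ (m i * y i ^ 2 / 2 + m j * y j ^ 2 / 2) * SS i j :=
                mul_le_mul_of_nonneg_right hAM (hSS0 i j)
            _ = m i * y i ^ 2 / 2 * SS i j + m j * y j ^ 2 / 2 * SS i j := by ring
      _ = ∑ i, ∑ j, m i * y i ^ 2 / 2 * SS i j + ∑ i, ∑ j, m j * y j ^ 2 / 2 * SS i j := by
          simp_rw [Finset.sum_add_distrib]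
      _ ≤ W * (N + J * θ) / 2 + W * (N + J * θ) / 2 := add_le_add hS1 hS2
      _ = W * (N + J * θ) := by ring
  -- leakage (Cauchy–Schwarz over `j`, then the entrywise bound)
  have hR : ∑ i, m i * (∑ j, x j * Real.sqrt (m j) * CS j i) ^ 2 ≤ J ^ 2 * m i₀ ^ 2 * θ ^ 2 := by
    have h1 : ∀ i, (∑ j, x j * Real.sqrt (m j) * CS j i) ^ 2 ≤ ∑ j, m j * CS j i ^ 2 := by
      intro i
      have h := Finset.sum_mul_sq_le_sq_mul_sq univ x (fun j ↦ Real.sqrt (m j) * CS j i)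
      rw [hx1, one_mul] at h
      calc (∑ j, x j * Real.sqrt (m j) * CS j i) ^ 2
          = (∑ j, x j * (Real.sqrt (m j) * CS j i)) ^ 2 := by simp_rw [mul_assoc]
        _ ≤ ∑ j, (Real.sqrt (m j) * CS j i) ^ 2 := h
        _ = ∑ j, m j * CS j i ^ 2 :=
            Finset.sum_congr rfl fun j _ ↦ by rw [mul_pow, Real.sq_sqrt (hm j).le]
    have h2 : ∀ i j, m j * CS j i ^ 2 ≤ m i₀ * θ ^ 2 := fun i j ↦ by
      have hsq : CS j i ^ 2 ≤ θ ^ 2 := by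
        rw [← sq_abs]
        exact pow_le_pow_left₀ (abs_nonneg _) (hCS j i) 2
      exact mul_le_mul (hi₀ j) hsq (sq_nonneg _) hM0.le
    calc ∑ i, m i * (∑ j, x j * Real.sqrt (m j) * CS j i) ^ 2
        ≤ ∑ i, m i * ∑ j, m j * CS j i ^ 2 :=
          Finset.sum_le_sum fun i _ ↦ mul_le_mul_of_nonneg_left (h1 i) (hm i).le
      _ ≤ ∑ _i : ι, m i₀ * ∑ _j : ι, m i₀ * θ ^ 2 :=
          Finset.sum_le_sum fun i _ ↦ mul_le_mul (hi₀ i) (Finset.sum_le_sum fun j _ ↦ h2 i j)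
            (Finset.sum_nonneg fun j _ ↦ mul_nonneg (hm j).le (sq_nonneg _)) hM0.le
      _ = (Fintype.card ι : ℝ) ^ 2 * m i₀ ^ 2 * θ ^ 2 := by
          simp only [Finset.sum_const, Finset.card_univ, nsmul_eq_mul]
          ring
      _ ≤ J ^ 2 * m i₀ ^ 2 * θ ^ 2 := by
          have hc : (Fintype.card ι : ℝ) ^ 2 ≤ J ^ 2 := pow_le_pow_left₀ (Nat.cast_nonneg _) hJ 2
          exact mul_le_mul_of_nonneg_right (mul_le_mul_of_nonneg_right hc (sq_nonneg _))
            (sq_nonneg _)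
  -- gain part (Cauchy–Schwarz against `x`)
  have hP : Λc ^ 2 ≤ ∑ i, m i * (∑ j, x j * Real.sqrt (m j) * CC j i) ^ 2 := by
    have h := Finset.sum_mul_sq_le_sq_mul_sq univ x
      (fun i ↦ Real.sqrt (m i) * ∑ j, x j * Real.sqrt (m j) * CC j i)
    rw [hx1, one_mul] at h
    have e1 : ∑ i, x i * (Real.sqrt (m i) * ∑ j, x j * Real.sqrt (m j) * CC j i) = Λc := by
      rw [← hΛc]
      refine Finset.sum_congr rfl fun i _ ↦ ?_
      rw [Finset.mul_sum, Finset.mul_sum]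
      refine Finset.sum_congr rfl fun j _ ↦ ?_
      rw [hCCsym i j]
      ring
    have e2 : ∑ i, (Real.sqrt (m i) * ∑ j, x j * Real.sqrt (m j) * CC j i) ^ 2 =
        ∑ i, m i * (∑ j, x j * Real.sqrt (m j) * CC j i) ^ 2 :=
      Finset.sum_congr rfl fun i _ ↦ by rw [mul_pow, Real.sq_sqrt (hm i).le]
    rw [e1, e2] at h
    exact h
  -- freeze the remaining big expressions and close by arithmetic
  have hPF' : u₀ * W ≤ Λc - Λs := by linarith
  have h3 : m i₀ * (N - θ / 4) ≤ W * (N + J * θ) := hΛs_ge.trans hSchur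
  clear_value W
  generalize hMdef : m i₀ = M at hM0 hΛc_ge h3 hR ⊢
  generalize hPdef : ∑ i, m i * (∑ j, x j * Real.sqrt (m j) * CC j i) ^ 2 = P at hP ⊢
  generalize hRdef : ∑ i, m i * (∑ j, x j * Real.sqrt (m j) * CS j i) ^ 2 = R at hR ⊢
  have hNJ : 0 < N + J * θ := by positivity
  have key : J ^ 2 * M ^ 2 * θ ^ 2 < Λc * (Λc - Λs) := by
    have h2 : M * N * (u₀ * W) ≤ Λc * (Λc - Λs) :=
      mul_le_mul hΛc_ge hPF' (mul_nonneg hu.le hW0) hΛc0.le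
    have h2' : (N + J * θ) * (M * N * (u₀ * W)) ≤ (N + J * θ) * (Λc * (Λc - Λs)) :=
      mul_le_mul_of_nonneg_left h2 hNJ.le
    have h4 : M * (N * u₀ * (M * (N - θ / 4))) ≤ M * (N * u₀ * (W * (N + J * θ))) :=
      mul_le_mul_of_nonneg_left (mul_le_mul_of_nonneg_left h3 (by positivity)) hM0.le
    have h5 : J ^ 2 * θ ^ 2 * (N + J * θ) * M ^ 2 < N * u₀ * (N - θ / 4) * M ^ 2 :=
      mul_lt_mul_of_pos_right hclose (by positivity)
    refine lt_of_mul_lt_mul_left ?_ hNJ.le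
    calc (N + J * θ) * (J ^ 2 * M ^ 2 * θ ^ 2) = J ^ 2 * θ ^ 2 * (N + J * θ) * M ^ 2 := by ring
      _ < N * u₀ * (N - θ / 4) * M ^ 2 := h5
      _ = M * (N * u₀ * (M * (N - θ / 4))) := by ring
      _ ≤ M * (N * u₀ * (W * (N + J * θ))) := h4
      _ = (N + J * θ) * (M * N * (u₀ * W)) := by ring
      _ ≤ (N + J * θ) * (Λc * (Λc - Λs)) := h2'
  have key' : Λs * Λc + J ^ 2 * M ^ 2 * θ ^ 2 < Λc ^ 2 := by
    have e : Λc * (Λc - Λs) = Λc ^ 2 - Λs * Λc := by ring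
    rw [e] at key
    linarith
  linarith [hP, hR, key']

/-! ## Summary statement (the registered sub-goal of this helper file) -/

/-- **Finite-dimensional core of TORUS-SEP** (closed form of `torusSep_matrixInequality`; see the
module docstring). [folklore] -/
theorem torusSep_gramMatrix :
    ∀ (ι : Type) [Fintype ι] [DecidableEq ι] (m : ι → ℝ) (CC SS CS : ι → ι → ℝ) (x y : ι → ℝ)
      (N θ u₀ J : ℝ), (∀ i, 0 < m i) → ∑ i, x i ^ 2 = 1 →
      (∀ z : ι → ℝ, ∑ i, ∑ j, z i * z j * (Real.sqrt (m i) * Real.sqrt (m j) * CC i j) ≤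
        (∑ i, ∑ j, x i * x j * (Real.sqrt (m i) * Real.sqrt (m j) * CC i j)) * ∑ i, z i ^ 2) →
      ∑ i, y i ^ 2 = 1 →
      (∀ z : ι → ℝ, ∑ i, ∑ j, z i * z j * (Real.sqrt (m i) * Real.sqrt (m j) * SS i j) ≤
        (∑ i, ∑ j, y i * y j * (Real.sqrt (m i) * Real.sqrt (m j) * SS i j)) * ∑ i, z i ^ 2) →
      0 < N → 0 ≤ θ → 0 < u₀ → (Fintype.card ι : ℝ) ≤ J → (∀ i j, CC i j = CC j i) →
      (∀ i j, 0 ≤ SS i j) → (∀ i j, i ≠ j → SS i j ≤ θ) → (∀ i, SS i i ≤ N) →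
      (∀ i, N - θ / 4 ≤ SS i i) → (∀ i j, SS i j ≤ CC i j) → (∀ i, SS i i + u₀ ≤ CC i i) →
      (∀ i, N ≤ CC i i) → (∀ i j, |CS i j| ≤ θ) →
      J ^ 2 * θ ^ 2 * (N + J * θ) < N * u₀ * (N - θ / 4) →
      (∑ i, ∑ j, y i * y j * (Real.sqrt (m i) * Real.sqrt (m j) * SS i j)) *
          (∑ i, ∑ j, x i * x j * (Real.sqrt (m i) * Real.sqrt (m j) * CC i j)) <
        ∑ i, m i * (∑ j, x j * Real.sqrt (m j) * CC j i) ^ 2 -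
          ∑ i, m i * (∑ j, x j * Real.sqrt (m j) * CS j i) ^ 2 :=
  fun _ _ _ m CC SS CS x y N θ u₀ J hm hx1 hxmax hy1 hymax hN hθ hu hJ hCCsym hSS0 hSSθ hSSN hSSN'
    hU hUd hCCN hCS hclose ↦
  torusSep_matrixInequality m CC SS CS x y N θ u₀ J hm hx1 hxmax hy1 hymax hN hθ hu hJ hCCsym hSS0
    hSSθ hSSN hSSN' hU hUd hCCN hCS hclose

end Summit.RiemannHypothesis.RiemannHypothesis.Theorems.WeilParityOffLineParityDetection

end
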